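import Summits.Ventures.CertifiedManyBodySolver.Rows.HalfFilledTLTorus
import Summits.Ventures.CertifiedManyBodySolver.Rows.HalfFilledTLWords
import Mathlib.Analysis.Matrix.PosDef
import Mathlib.Algebra.Order.Chebyshev

/-!
# M2 rows, part 21 — the identity MINOR of Lieb's spin-reflection-positivity GRAM block: hopping² controls the bond spin correlation; on TLGS(U), `C₁ ≤ -(3/128)·k²`

HONEST FRAMING: first certified bounds; not a superconductivity verdict; every number certified or
labelled float.  This file adds NO certified number and imports NO certificate.  It is the tree home of the
zero-compute theorem edge staged (lean-checked, never proposed) by the M2 IMPORT seat `pub-mbboot-adv-2` in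
`LiebGramMinor.lean` v1.1 §1–§4 (sha256 bb22388f…; companion `m2/RP-MINOR-CARD.md` v1.1), NAMES KEPT, all in
namespace `…CertifiedManyBodySolver.M2` (Rows convention); its by-name instances over CERTIFIED.md claim nodes
are part 22 (`Rows/HalfFilledTLCertJoins6.lean`) — vocabulary files never import `Certificates/`.

Take Lieb's Gram block `hubbardTorus_liebGram_posSemidef` (THE half-filled ground state `ψ` of the even
`L × L` torus, `t ≠ 0`, `U > 0`) on the TWO words `w 0 = []`, `w 1 = [(x, y)]`: the `2 × 2`
positive-semidefinite minor `[[⟨ψ,ψ⟩, ε_xε_y ⟨ψ, c_{x↓}c†_{y↓} ψ⟩], [⟨ψ, c†_{x↑}c_{y↑} ψ⟩, ε_xε_y ⟨ψ, S⁺_x S⁻_y ψ⟩]]`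
has non-negative determinant:

* §1–§2 `hubbardTorus_normSq_expect_upHop_le` — `|⟨ψ, c†_{x↑}c_{y↑} ψ⟩|² ≤ Re(⟨ψ,ψ⟩ · ε_xε_y ⟨ψ, S⁺_x S⁻_y ψ⟩)`
  for all `x, y`; `hubbardTorus_re_expect_fermionSpinDot_le_of_adj` — on a bond (`ε_xε_y = -1`,
  `torusSign_mul_torusSign_of_adj`), with the singlet isotropy `⟨𝐒_x·𝐒_y⟩ = (3/2)⟨S⁺_xS⁻_y⟩`
  (`expect_fermionSpinDot_eq_of_singlet`; `S^±ψ = 0` by Lieb `S = 0`, `hubbardTorus_spinPlus_spinMinus_mulVec_eq_zero`)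
  and the spin symmetry of the hopping amplitude `⟨c†_{x↓}c_{y↓}⟩ = ⟨c†_{x↑}c_{y↑}⟩`
  (`expect_upHop_eq_downHop_of_singlet`): `⟨ψ,ψ⟩ · Re ⟨ψ, 𝐒_x·𝐒_y ψ⟩ ≤ -(3/2) |⟨ψ, c†_{xσ}c_{yσ} ψ⟩|²`, either `σ`.
* §3–§4 `IsTLGS.re_expect_spinDotAt_le_neg_sq_hop` — the torus limit (translation average + Jensen
  `avg_le_mul_sq_avg` + weak-⋆ limit, pattern of `IsTorusLimitOf.re_expect_spinDotAt_nonpos_of_adj`): for every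
  `ω ∈ TLGS(U)`, `U > 0`, `i, σ`: `Re ω(𝐒_0·𝐒_{e_i}) ≤ -(3/2) (Re ω(c†_{0σ}c_{e_iσ}))²`;
  `IsTLGS.re_expect_spinNN_le_neg_kinetic_sq` — summing the four `(i, σ)` minors with the bond symmetry
  `ω(𝐒_0·𝐒_{e₂}) = ω(𝐒_0·𝐒_{e₁})` (`IsTLGS.expect_spinDotAt_e2_eq`, part 5) and
  `Re ω(T₀) = 2 Σ_{iσ} Re ω(c†_{0σ}c_{e_iσ})` (`re_expect_hoppingNN_eq`): **`C₁ ≤ -(3/128) k²`**,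
  `C₁ = Re ω(𝐒_0·𝐒_{e₁})`, `k = Re ω(k₀)`; ROW FORMS `SpinNNRow.clip_kinetic : SpinNNRow U lo hi →
  KineticRow U klo khi → khi ≤ 0 → SpinNNRow U lo (min hi (-(3·khi²/128)))` and `SpinNNRow.clip_energy_docc`
  (through `KineticRow.of_energy_docc`, part 4).

The constant is SHARP at weak coupling: for the half-filled free Fermi sea (Wick) `⟨𝐒_0·𝐒_{e}⟩ = -(3/2)p²` with
`p = ⟨c†_{0σ}c_{eσ}⟩ = -k/8`, i.e. `C₁ = -(3/128)k²` exactly.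

READING RULE (binding, as parts 11 / 13 / 14 / 17): these are THEOREM edges; a table endpoint obtained through
them from certified energy / kinetic rows is a `corollary (certified + theorem)` — hypothesis-grade in the claim
nodes it consumes, never itself "certified", never in an M2-width verdict, the tightest-visible pool or the §0a
count; as a PIPELINE CONTROL (m2-5 `derived_controls`, report-only) a certified `spin_nn` FLOOR above
`-(3/128)·khi²` for a certified kinetic ceiling `khi ≤ 0` of the same TLGS class is a CONTRADICTION.

References: E. H. Lieb, PRL 62 (1989) 1201, proof of Theorem 2 [cite: LiebPRL1989, proof of Theorem 2];
G.-S. Tian, J. Stat. Phys. 116 (2004) 629, §§3–5 [cite: Tian2004, §3]; S.-Q. Shen, Z.-M. Qiu, G.-S. Tian,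
PRL 72 (1994) 1280 [cite: ShenQiuTian1994, Theorem and eqs. (7)–(9)]; O. Bratteli, D. W. Robinson I §4.3.1
[cite: BratteliRobinsonI1987, §4.3.1].
-/

noncomputable section

namespace Summit.Ventures.CertifiedManyBodySolver

open Literature.MathematicalPhysics.QuantumLattice
open Matrix Finset HubbardWave0 Literature.Probability.LatticeModels FermionSpinMoment LiebTwo ThermodynamicLimit
open Filter Topology
open Summit.HubbardSuperconductivity.ManyBodyBootstrap.Bounds
open scoped ComplexOrder BigOperators

namespace M2

/-! ## §1 Algebra: the `2 × 2` minor and the spin symmetry of the hopping amplitude -/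

/-- The `(1,0)` minor of a positive-semidefinite `2 × 2` complex matrix:
`|M₁₀|² ≤ Re (M₀₀ M₁₁)` (`det M ≥ 0` and `M₀₁ = conj M₁₀`). [folklore] -/
theorem normSq_le_re_mul_of_posSemidef {M : Matrix (Fin 2) (Fin 2) ℂ} (hM : M.PosSemidef) :
    ‖M 1 0‖ ^ 2 ≤ (M 0 0 * M 1 1).re := by
  have hdet := hM.det_nonneg
  rw [Matrix.det_fin_two, ← hM.1.apply 0 1, Complex.star_def, Complex.conj_mul',
    ← Complex.ofReal_pow] at hdet
  have h := (Complex.nonneg_iff.mp hdet).1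
  rw [Complex.sub_re, Complex.ofReal_re] at h
  linarith

section Singlet

variable {Λ : Type*} [LinearOrder Λ] [Fintype Λ]

/-- `[c†_{x↑} c_{y↓}, S⁻] = c†_{x↑} c_{y↑} - c†_{x↓} c_{y↓}` (bilinear commutator, summed over the
sites of `S⁻ = Σ_z c†_{z↓} c_{z↑}`). [cite: EsslerEtAl2005, §2.2.5 eqs. (2.71)–(2.73)] -/
theorem upDownHop_mul_spinMinus_sub (x y : Λ) :
    creation (orb x 0) * annihilation (orb y 1) * spinMinus -
        spinMinus * (creation (orb x 0) * annihilation (orb y 1)) =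
      creation (orb x 0) * annihilation (orb y 0) - creation (orb x 1) * annihilation (orb y 1) := by
  rw [← sum_fermionSpinMinus, Finset.mul_sum, Finset.sum_mul, ← Finset.sum_sub_distrib]
  simp only [fermionSpinMinus, LiebThm1.creation_mul_annihilation_commutator, orb_inj, and_true,
    Finset.sum_sub_distrib, Finset.sum_ite_eq, Finset.mem_univ, if_true]

/-- **Spin symmetry of the hopping amplitude on singlets**: `S⁺ ψ = S⁻ ψ = 0` implies
`⟨ψ, c†_{x↑} c_{y↑} ψ⟩ = ⟨ψ, c†_{x↓} c_{y↓} ψ⟩` (the commutator `[c†_{x↑}c_{y↓}, S⁻]` has zero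
expectation). [cite: EsslerEtAl2005, §2.2.5 eqs. (2.71)–(2.73)] -/
theorem expect_upHop_eq_downHop_of_singlet {ψ : Fock (Orb Λ)} (hP : spinPlus *ᵥ ψ = 0)
    (hM : spinMinus *ᵥ ψ = 0) (x y : Λ) :
    star ψ ⬝ᵥ ((creation (orb x 0) * annihilation (orb y 0)) *ᵥ ψ) =
      star ψ ⬝ᵥ ((creation (orb x 1) * annihilation (orb y 1)) *ᵥ ψ) := by
  have h := congrArg (fun A : Matrix (Finset (Orb Λ)) (Finset (Orb Λ)) ℂ => star ψ ⬝ᵥ (A *ᵥ ψ))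
    (upDownHop_mul_spinMinus_sub x y)
  have h1 : star ψ ⬝ᵥ ((spinMinus * (creation (orb x 0) * annihilation (orb y 1))) *ᵥ ψ) = 0 := by
    rw [← mulVec_mulVec, spinMinus, dotProduct_mulVec, ← star_mulVec, hP, star_zero, zero_dotProduct]
  rw [sub_mulVec, dotProduct_sub, h1, sub_zero, ← mulVec_mulVec, hM, mulVec_zero, dotProduct_zero,
    sub_mulVec, dotProduct_sub] at h
  exact sub_eq_zero.1 h.symm

/-- The empty up-spin word is the identity. [cite: LiebPRL1989, proof of Theorem 2] -/
theorem upWord_nil' : upWord ([] : List (Λ × Λ)) = 1 := by simp [upWord]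

/-- The empty Shiba-transformed down-spin word is the identity. [cite: LiebPRL1989, proof of Theorem 2] -/
theorem shibaDownWord_nil' (ε : Λ → ℂ) : shibaDownWord ε ([] : List (Λ × Λ)) = 1 := by
  simp [shibaDownWord]

/-- The one-letter up-spin word `W_↑[(x,y)] = c†_{x↑} c_{y↑}`. [cite: LiebPRL1989, proof of Theorem 2] -/
theorem upWord_pair' (x y : Λ) : upWord [(x, y)] = creation (orb x 0) * annihilation (orb y 0) := by
  simp [upWord]

/-- **The identity minor of a Lieb Gram block** (orbital-generic): if the `2 × 2` Gram block of `ψ` on the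
words `[]`, `[(x, y)]` (Shiba sign `ε`) is positive semidefinite then `|⟨ψ, c†_{x↑} c_{y↑} ψ⟩|² ≤
Re (⟨ψ,ψ⟩ · ε_x ε_y ⟨ψ, S⁺_x S⁻_y ψ⟩)`. [cite: LiebPRL1989, proof of Theorem 2] [cite: Tian2004, §3] -/
theorem normSq_expect_upHop_le_of_liebGramMinor (ε : Λ → ℂ) (ψ : Fock (Orb Λ)) (x y : Λ)
    (hM : (Matrix.of fun a b : Fin 2 =>
      star ψ ⬝ᵥ ((upWord (![([] : List (Λ × Λ)), [(x, y)]] a) *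
        shibaDownWord ε (![([] : List (Λ × Λ)), [(x, y)]] b)) *ᵥ ψ)).PosSemidef) :
    ‖star ψ ⬝ᵥ ((creation (orb x 0) * annihilation (orb y 0)) *ᵥ ψ)‖ ^ 2 ≤
      ((star ψ ⬝ᵥ ψ) * (ε x * ε y *
        (star ψ ⬝ᵥ ((fermionSpinPlus x * fermionSpinMinus y) *ᵥ ψ)))).re := by
  have h := normSq_le_re_mul_of_posSemidef hM
  simp only [Matrix.of_apply, Matrix.cons_val_zero, Matrix.cons_val_one] at h
  rw [upWord_pair_mul_shibaDownWord_pair, shibaDownWord_nil', upWord_nil', upWord_pair', mul_one,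
    mul_one, one_mulVec, Matrix.smul_mulVec, dotProduct_smul, smul_eq_mul] at h
  exact h

end Singlet

/-! ## §2 The even square torus at half filling -/

section Torus

variable {L : ℕ} [NeZero L]

omit [NeZero L] in
/-- `|(ℤ/Lℤ)²| = L²`. [folklore] -/
private theorem card_fermionTorus_two'' : Fintype.card (FermionTorus 2 L) = L ^ 2 := by
  simp only [FermionTorus, Fintype.card_lex, Fintype.card_fun, Fintype.card_fin]

/-- THE half-filled ground state of the even torus is a spin singlet: `S⁺ ψ = S⁻ ψ = 0`
(Lieb's `S = 0` + `S² ψ = 0 ⇒ S^± ψ = 0`). [cite: LiebPRL1989, Theorem 2] -/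
theorem hubbardTorus_spinPlus_spinMinus_mulVec_eq_zero (hL : Even L) {t U : ℝ} (ht : t ≠ 0)
    (hU : 0 < U) {ψ : Fock (Orb (FermionTorus 2 L))} (hN : IsNParticle (L ^ 2) ψ)
    (hHψ : hamiltonian (fermionTorusGraph 2 L) t U *ᵥ ψ =
      ((groundEnergyAt (fermionTorusGraph 2 L) t U (L ^ 2) : ℝ) : ℂ) • ψ) :
    spinPlus *ᵥ ψ = 0 ∧ spinMinus *ᵥ ψ = 0 := by
  obtain ⟨hG, hA, h2, -⟩ := LiebHalfFilled.hubbardTorus_lieb_hypotheses (L := L) hL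
  have hcard := LiebHalfFilled.compl_card_eq_card_of_two_mul h2
  rw [← card_fermionTorus_two''] at hN hHψ
  have hmem : ψ ∈ (hamiltonian (fermionTorusGraph 2 L) t U).sectorGroundSpace
      (nParticleSubmodule (ι := Orb (FermionTorus 2 L)) (Fintype.card (FermionTorus 2 L))) :=
    (LiebHalfFilled.mem_groundSector_iff (fermionTorusGraph 2 L) t U _ ψ).2 ⟨hN, hHψ⟩
  have hS := (LiebHalfFilled.finrank_groundSector_eq_one hG _ hA hcard ht hU).2 ψ hmem
  obtain ⟨hP, hM, -⟩ := spin_mulVec_eq_zero_of_spinSq_mulVec_eq_zero hS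
  exact ⟨hP, hM⟩

/-- **The identity minor of Lieb's Gram block.** For THE half-filled ground state `ψ` of the even
torus (`t ≠ 0`, `U > 0`) and all sites `x, y`:
`|⟨ψ, c†_{x↑} c_{y↑} ψ⟩|² ≤ Re (⟨ψ,ψ⟩ · ε_x ε_y ⟨ψ, S⁺_x S⁻_y ψ⟩)` — the `2 × 2` minor of
`hubbardTorus_liebGram_posSemidef` on the words `[]`, `[(x, y)]`, through the orbital-generic
`normSq_expect_upHop_le_of_liebGramMinor`. [cite: LiebPRL1989, proof of Theorem 2] [cite: Tian2004, §3] -/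
theorem hubbardTorus_normSq_expect_upHop_le (hL : Even L) {t U : ℝ} (ht : t ≠ 0) (hU : 0 < U)
    {ψ : Fock (Orb (FermionTorus 2 L))} (hN : IsNParticle (L ^ 2) ψ)
    (hHψ : hamiltonian (fermionTorusGraph 2 L) t U *ᵥ ψ =
      ((groundEnergyAt (fermionTorusGraph 2 L) t U (L ^ 2) : ℝ) : ℂ) • ψ) (x y : FermionTorus 2 L) :
    ‖star ψ ⬝ᵥ ((creation (orb x 0) * annihilation (orb y 0)) *ᵥ ψ)‖ ^ 2 ≤
      ((star ψ ⬝ᵥ ψ) * (torusSign x * torusSign y *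
        (star ψ ⬝ᵥ ((fermionSpinPlus x * fermionSpinMinus y) *ᵥ ψ)))).re :=
  normSq_expect_upHop_le_of_liebGramMinor torusSign ψ x y
    (hubbardTorus_liebGram_posSemidef hL ht hU hN hHψ
      ![([] : List (FermionTorus 2 L × FermionTorus 2 L)), [(x, y)]])

omit [NeZero L] in
/-- On a bond of the even torus `ε_x ε_y = -1`. [cite: LiebPRL1989, Theorem 2 (bipartite lattice)] -/
theorem torusSign_mul_torusSign_of_adj (hL : Even L) {x y : FermionTorus 2 L}
    (hxy : (fermionTorusGraph 2 L).Adj x y) : torusSign x * torusSign y = -1 := by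
  unfold torusSign
  rw [torusStagger_eq_neg_of_adj_holds hL hxy, Units.val_neg, Int.cast_neg, neg_mul, ← Int.cast_mul,
    ← Units.val_mul, Int.units_mul_self, Units.val_one, Int.cast_one]

/-- **Hopping² controls the bond spin correlation.** For THE half-filled ground state `ψ` of the even
torus (`t ≠ 0`, `U > 0`), every bond `x ∼ y` and either spin `σ`:
`⟨ψ,ψ⟩ · Re ⟨ψ, 𝐒_x·𝐒_y ψ⟩ ≤ -(3/2) |⟨ψ, c†_{xσ} c_{yσ} ψ⟩|²` (identity minor, `ε_xε_y = -1`,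
singlet isotropy `⟨𝐒_x·𝐒_y⟩ = (3/2)⟨S⁺_xS⁻_y⟩`, spin symmetry of the hopping amplitude).
[cite: LiebPRL1989, proof of Theorem 2] [cite: ShenQiuTian1994, Theorem and eqs. (7)–(9)] -/
theorem hubbardTorus_re_expect_fermionSpinDot_le_of_adj (hL : Even L) {t U : ℝ} (ht : t ≠ 0)
    (hU : 0 < U) {ψ : Fock (Orb (FermionTorus 2 L))} (hN : IsNParticle (L ^ 2) ψ)
    (hHψ : hamiltonian (fermionTorusGraph 2 L) t U *ᵥ ψ =
      ((groundEnergyAt (fermionTorusGraph 2 L) t U (L ^ 2) : ℝ) : ℂ) • ψ) {x y : FermionTorus 2 L}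
    (hxy : (fermionTorusGraph 2 L).Adj x y) (σ : Fin 2) :
    (star ψ ⬝ᵥ ψ).re * (star ψ ⬝ᵥ (fermionSpinDot x y *ᵥ ψ)).re ≤
      -(3 / 2) * ‖star ψ ⬝ᵥ ((creation (orb x σ) * annihilation (orb y σ)) *ᵥ ψ)‖ ^ 2 := by
  obtain ⟨hP, hM⟩ := hubbardTorus_spinPlus_spinMinus_mulVec_eq_zero hL ht hU hN hHψ
  have hσ : star ψ ⬝ᵥ ((creation (orb x σ) * annihilation (orb y σ)) *ᵥ ψ) =
      star ψ ⬝ᵥ ((creation (orb x 0) * annihilation (orb y 0)) *ᵥ ψ) := by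
    fin_cases σ
    · rfl
    · exact (expect_upHop_eq_downHop_of_singlet hP hM x y).symm
  rw [hσ]
  have hmin := hubbardTorus_normSq_expect_upHop_le hL ht hU hN hHψ x y
  rw [torusSign_mul_torusSign_of_adj hL hxy] at hmin
  have hiso := expect_fermionSpinDot_eq_of_singlet hP hM x y
  have hn : (star ψ ⬝ᵥ ψ).im = 0 := by
    have h0 : 0 ≤ star ψ ⬝ᵥ ψ := dotProduct_star_self_nonneg _
    exact (Complex.nonneg_iff.mp h0).2.symm
  have hre : (star ψ ⬝ᵥ (fermionSpinDot x y *ᵥ ψ)).re =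
      (3 / 2) * (star ψ ⬝ᵥ ((fermionSpinPlus x * fermionSpinMinus y) *ᵥ ψ)).re := by
    rw [hiso, show (3 / 2 : ℂ) = ((3 / 2 : ℝ) : ℂ) by push_cast; ring, Complex.re_ofReal_mul]
  have hprod : ((star ψ ⬝ᵥ ψ) * (-1 * (star ψ ⬝ᵥ ((fermionSpinPlus x * fermionSpinMinus y) *ᵥ ψ)))).re =
      -((star ψ ⬝ᵥ ψ).re * (star ψ ⬝ᵥ ((fermionSpinPlus x * fermionSpinMinus y) *ᵥ ψ)).re) := by
    rw [Complex.mul_re, hn, zero_mul, sub_zero, neg_one_mul, Complex.neg_re, mul_neg]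
  rw [hprod] at hmin
  rw [hre]
  nlinarith [hmin]

/-- Normalised form (`⟨ψ,ψ⟩ = 1`), real-part version: `Re ⟨ψ, 𝐒_x·𝐒_y ψ⟩ ≤ -(3/2) (Re ⟨ψ, c†_{xσ}c_{yσ} ψ⟩)²`.
[cite: LiebPRL1989, proof of Theorem 2] [cite: ShenQiuTian1994, Theorem and eqs. (7)–(9)] -/
theorem hubbardTorus_re_expect_fermionSpinDot_le_of_adj_of_norm_one (hL : Even L) {t U : ℝ}
    (ht : t ≠ 0) (hU : 0 < U) {ψ : Fock (Orb (FermionTorus 2 L))} (hN : IsNParticle (L ^ 2) ψ)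
    (hHψ : hamiltonian (fermionTorusGraph 2 L) t U *ᵥ ψ =
      ((groundEnergyAt (fermionTorusGraph 2 L) t U (L ^ 2) : ℝ) : ℂ) • ψ)
    (h1 : star ψ ⬝ᵥ ψ = 1) {x y : FermionTorus 2 L} (hxy : (fermionTorusGraph 2 L).Adj x y)
    (σ : Fin 2) :
    (star ψ ⬝ᵥ (fermionSpinDot x y *ᵥ ψ)).re ≤
      -(3 / 2) * ((star ψ ⬝ᵥ ((creation (orb x σ) * annihilation (orb y σ)) *ᵥ ψ)).re) ^ 2 := by
  have h := hubbardTorus_re_expect_fermionSpinDot_le_of_adj hL ht hU hN hHψ hxy σ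
  rw [h1, Complex.one_re, one_mul] at h
  have hz : ((star ψ ⬝ᵥ ((creation (orb x σ) * annihilation (orb y σ)) *ᵥ ψ)).re) ^ 2 ≤
      ‖star ψ ⬝ᵥ ((creation (orb x σ) * annihilation (orb y σ)) *ᵥ ψ)‖ ^ 2 := by
    rw [Complex.sq_norm, Complex.normSq_apply]
    nlinarith [sq_nonneg (star ψ ⬝ᵥ ((creation (orb x σ) * annihilation (orb y σ)) *ᵥ ψ)).im]
  linarith

end Torus

/-! ## §3 Transfer to the torus limit -/

section Transfer

/-- The pull-back of the window hopping word is the torus hopping word of the images: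
`Γ(ι_{Λ,L}) (c†_{xσ} c_{yσ}) = c†_{x mod L,σ} c_{y mod L,σ}`. [cite: ArakiMoriya2003, §4.1 Def. 4.3] -/
theorem fermionEmbed_toTorusEmb_hop (L : ℕ) [NeZero L] {Λ : Finset (Site 2)}
    (hInj : Set.InjOn (Torus.proj (d := 2) L) ↑Λ) {x y : Site 2} (hx : x ∈ Λ) (hy : y ∈ Λ) (σ : Fin 2) :
    fermionEmbed (PolySite.toTorusEmb L hInj) ((cAt x hx σ)ᴴ * cAt y hy σ) =
      creation (orb (FermionTorus.ofTorusSite (Torus.proj L x)) σ) *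
        annihilation (orb (FermionTorus.ofTorusSite (Torus.proj L y)) σ) := by
  rw [fermionEmbed_mul, fermionEmbed_conjTranspose, cAt, cAt, fermionEmbed_annihilation,
    fermionEmbed_annihilation, annihilation_conjTranspose]
  rfl

/-- **Jensen step of the transfer**: if `a_v ≤ c · b_v²` for every translate `v` with `c ≤ 0`, then the
averages satisfy `avg a ≤ c · (avg b)²` (`(Σ b)² ≤ N Σ b²`). [cite: BratteliRobinsonI1987, §4.3.1] -/
theorem avg_le_mul_sq_avg {ι : Type*} [Fintype ι] [Nonempty ι] {a b : ι → ℝ} {c : ℝ} (hc : c ≤ 0)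
    (h : ∀ v, a v ≤ c * (b v) ^ 2) :
    (Fintype.card ι : ℝ)⁻¹ * ∑ v, a v ≤ c * ((Fintype.card ι : ℝ)⁻¹ * ∑ v, b v) ^ 2 := by
  set N : ℝ := (Fintype.card ι : ℝ) with hN
  have hNpos : 0 < N := by rw [hN]; exact_mod_cast Fintype.card_pos
  have h1 : ∑ v, a v ≤ c * ∑ v, (b v) ^ 2 := by
    calc ∑ v, a v ≤ ∑ v, c * (b v) ^ 2 := Finset.sum_le_sum fun v _ => h v
      _ = c * ∑ v, (b v) ^ 2 := by rw [Finset.mul_sum]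
  have h2 : (∑ v, b v) ^ 2 ≤ N * ∑ v, (b v) ^ 2 := by
    have := sq_sum_le_card_mul_sum_sq (s := Finset.univ) (f := b)
    rwa [Finset.card_univ] at this
  have h3 : c * (N⁻¹ * ∑ v, b v) ^ 2 = N⁻¹ * (c * N⁻¹ * (∑ v, b v) ^ 2) := by ring
  rw [h3]
  refine mul_le_mul_of_nonneg_left ?_ (inv_nonneg.2 hNpos.le)
  have hcN : c * N⁻¹ ≤ 0 := mul_nonpos_iff.2 (Or.inr ⟨hc, inv_nonneg.2 hNpos.le⟩)
  calc ∑ v, a v ≤ c * ∑ v, (b v) ^ 2 := h1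
    _ = c * N⁻¹ * (N * ∑ v, (b v) ^ 2) := by
        rw [mul_assoc, ← mul_assoc N⁻¹, inv_mul_cancel₀ hNpos.ne', one_mul]
    _ ≤ c * N⁻¹ * (∑ v, b v) ^ 2 := mul_le_mul_of_nonpos_left h2 hcN

end Transfer

/-! ## §4 TLGS(U): the minor in the thermodynamic limit and the kinetic control of `C₁` -/

/-- **The identity minor on TLGS(U)**: for every `ω ∈ TLGS(U)` (`U > 0`), `i, σ ∈ {0,1}`:
`Re ω(𝐒_0·𝐒_{e_i}) ≤ -(3/2) (Re ω(c†_{0σ} c_{e_iσ}))²` (both words read in the window `{0,e₁,e₂}`).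
Finite-volume minor for every translate of `ψ_L` (again THE ground state, norm `1`), average +
Jensen, weak-⋆ limit. [cite: LiebPRL1989, proof of Theorem 2] [cite: BratteliRobinsonI1987, §4.3.1] -/
theorem IsTLGS.re_expect_spinDotAt_le_neg_sq_hop {U : ℝ} (hU : 0 < U) {ω : InfVolFermionState 2}
    (hω : IsTLGS U ω) (i σ : Fin 2) :
    (ω.expect nnSupport (spinDotAt 0 zero_mem_nnSupport (unitVec i) (unitVec_mem_nnSupport i))).re ≤
      -(3 / 2) * ((ω.expect nnSupport
        ((cAt 0 zero_mem_nnSupport σ)ᴴ * cAt (unitVec i) (unitVec_mem_nnSupport i) σ)).re) ^ 2 := by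
  obtain ⟨Ls, ψ, hLs, hev, hψ, hn, hω'⟩ := hω
  have hfA := (Complex.continuous_re.tendsto _).comp
    (hω' nnSupport (spinDotAt 0 zero_mem_nnSupport (unitVec i) (unitVec_mem_nnSupport i)))
  have hfB := ((((Complex.continuous_re.tendsto _).comp (hω' nnSupport
    ((cAt 0 zero_mem_nnSupport σ)ᴴ * cAt (unitVec i) (unitVec_mem_nnSupport i) σ))).pow 2).const_mul
      (-(3 / 2) : ℝ))
  refine le_of_tendsto_of_tendsto hfA hfB ?_
  obtain ⟨L₀, hL₀⟩ := exists_forall_le_injOn_proj (thicken nnSupport 1)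
  filter_upwards [hLs.eventually (eventually_ge_atTop (max L₀ 1))] with j hj
  have hL1 : 1 ≤ Ls j := le_trans (le_max_right _ _) hj
  haveI : NeZero (Ls j) := ⟨by omega⟩
  have hInj1 : Set.InjOn (Torus.proj (d := 2) (Ls j)) ↑(thicken nnSupport 1) :=
    hL₀ _ (le_trans (le_max_left _ _) hj)
  have hInj : Set.InjOn (Torus.proj (d := 2) (Ls j)) ↑nnSupport :=
    hInj1.mono (by exact_mod_cast subset_thicken nnSupport 1)
  simp only [Function.comp]
  rw [torusAvgExpect_eq, torusAvgExpect_eq, torusAvgExpectAt_of_injOn (Ls j) hInj,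
    torusAvgExpectAt_of_injOn (Ls j) hInj, ← Complex.ofReal_natCast, ← Complex.ofReal_inv]
  simp only [Complex.re_ofReal_mul, Complex.re_sum]
  have hadj : (fermionTorusGraph 2 (Ls j)).Adj (FermionTorus.ofTorusSite (Torus.proj (Ls j) 0))
      (FermionTorus.ofTorusSite (Torus.proj (Ls j) (unitVec i))) :=
    (fermionTorusGraph_adj_ofTorusSite_proj_iff (Ls j) hInj1 zero_mem_nnSupport
      (unitVec_mem_nnSupport i)).2 (zdGraph_adj_zero_unitVec i)
  refine avg_le_mul_sq_avg (by norm_num) fun v => ?_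
  have hGS := isGroundState_fockTranslate_mulVec 1 U v (hψ j)
  have hnorm : star ((fockTranslate v).val *ᵥ ψ (Ls j)) ⬝ᵥ ((fockTranslate v).val *ᵥ ψ (Ls j)) = 1 := by
    rw [star_dotProduct_fockTranslate_mulVec, hn j]
  rw [fermionEmbed_toTorusEmb_spinDotAt, fermionEmbed_toTorusEmb_hop]
  exact hubbardTorus_re_expect_fermionSpinDot_le_of_adj_of_norm_one (hev j) one_ne_zero hU hGS.1
    hGS.2.2 hnorm hadj σ

/-- **`Re ω(T₀) = 2 Σ_{i,σ} Re ω(c†_{0σ} c_{e_iσ})`** for every state (the h.c. word has the conjugate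
expectation, `expect_conjTranspose`). [cite: BratteliRobinsonI1987, §2.3.2] -/
theorem re_expect_hoppingNN_eq (ω : InfVolFermionState 2) :
    (ω.expect nnSupport hoppingNN).re =
      2 * ∑ i : Fin 2, ∑ σ : Fin 2, (ω.expect nnSupport
        ((cAt 0 zero_mem_nnSupport σ)ᴴ * cAt (unitVec i) (unitVec_mem_nnSupport i) σ)).re := by
  unfold hoppingNN
  rw [map_sum, Complex.re_sum, Finset.mul_sum]
  refine Finset.sum_congr rfl fun i _ => ?_
  rw [map_sum, Complex.re_sum, Finset.mul_sum]
  refine Finset.sum_congr rfl fun σ _ => ?_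
  have hh : (cAt (unitVec i) (unitVec_mem_nnSupport i) σ)ᴴ * cAt 0 zero_mem_nnSupport σ =
      ((cAt 0 zero_mem_nnSupport σ)ᴴ * cAt (unitVec i) (unitVec_mem_nnSupport i) σ)ᴴ := by
    rw [conjTranspose_mul, conjTranspose_conjTranspose]
  rw [map_add, Complex.add_re, hh, ω.expect_conjTranspose, Complex.star_def, Complex.conj_re]
  ring

/-- **Kinetic control of the bond spin correlation on TLGS(U)** (`U > 0`):
`Re ω(𝐒_0·𝐒_{e₁}) ≤ -(3/128) · k_ω²`, `k_ω = Re ω(k₀)` the kinetic energy per site — the four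
`(i, σ)` minors, `ω(𝐒_0·𝐒_{e₂}) = ω(𝐒_0·𝐒_{e₁})`, `k = -2 Σ_{iσ} Re ω(c†_{0σ}c_{e_iσ})` and
`(Σ_{iσ} p)² ≤ 4 Σ_{iσ} p²`. [cite: LiebPRL1989, proof of Theorem 2] [cite: BratteliRobinsonII1997, §6.2.4] -/
theorem IsTLGS.re_expect_spinNN_le_neg_kinetic_sq {U : ℝ} (hU : 0 < U) {ω : InfVolFermionState 2}
    (hω : IsTLGS U ω) :
    (ω.expect ({0, unitVec 0} : Finset (Site 2)) spinNNObs).re ≤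
      -(3 / 128) * ((ω.expect nnSupport (kineticWords (-1))).re) ^ 2 := by
  set p : Fin 2 → Fin 2 → ℝ := fun i σ => (ω.expect nnSupport
    ((cAt 0 zero_mem_nnSupport σ)ᴴ * cAt (unitVec i) (unitVec_mem_nnSupport i) σ)).re with hp
  have hC0 : ∀ σ : Fin 2,
      (ω.expect ({0, unitVec 0} : Finset (Site 2)) spinNNObs).re ≤ -(3 / 2) * (p 0 σ) ^ 2 := by
    intro σ
    have h := hω.re_expect_spinDotAt_le_neg_sq_hop hU 0 σ
    rwa [expect_spinDotAt_e1_eq_spinNNObs] at h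
  have hC1 : ∀ σ : Fin 2,
      (ω.expect ({0, unitVec 0} : Finset (Site 2)) spinNNObs).re ≤ -(3 / 2) * (p 1 σ) ^ 2 := by
    intro σ
    have h := hω.re_expect_spinDotAt_le_neg_sq_hop hU 1 σ
    rwa [hω.expect_spinDotAt_e2_eq hU, expect_spinDotAt_e1_eq_spinNNObs] at h
  have hk : (ω.expect nnSupport (kineticWords (-1))).re = -2 * (p 0 0 + p 0 1 + p 1 0 + p 1 1) := by
    rw [kineticWords_eq, map_smul, smul_eq_mul, ← Complex.ofReal_ratCast, Complex.re_ofReal_mul,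
      re_expect_hoppingNN_eq]
    simp only [Fin.sum_univ_two, hp]
    push_cast
    ring
  rw [hk]
  nlinarith [hC0 0, hC0 1, hC1 0, hC1 1, sq_nonneg (p 0 0 - p 0 1), sq_nonneg (p 0 0 - p 1 0),
    sq_nonneg (p 0 0 - p 1 1), sq_nonneg (p 0 1 - p 1 0), sq_nonneg (p 0 1 - p 1 1),
    sq_nonneg (p 1 0 - p 1 1)]

/-- **Row form**: a kinetic ceiling `k ≤ khi ≤ 0` clips a `spin_nn` cell's ceiling at `-(3/128) khi²`:
`SpinNNRow U lo hi → KineticRow U klo khi → khi ≤ 0 → SpinNNRow U lo (min hi (-(3 khi²/128)))`.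
[cite: LiebPRL1989, proof of Theorem 2] [cite: WangEtAl2024, §III] -/
theorem SpinNNRow.clip_kinetic {U : ℝ} (hU : 0 < U) {lo hi klo khi : ℚ} (h : SpinNNRow U lo hi)
    (hk : KineticRow U klo khi) (hkhi : khi ≤ 0) :
    SpinNNRow U lo (min hi (-(3 * khi ^ 2 / 128))) := by
  intro ω hω
  obtain ⟨hlo, hhi⟩ := h ω hω
  obtain ⟨-, hkhi'⟩ := hk ω hω
  refine ⟨hlo, ?_⟩
  have hmain := hω.re_expect_spinNN_le_neg_kinetic_sq hU
  have hq : ((khi : ℚ) : ℝ) ≤ 0 := by exact_mod_cast hkhi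
  push_cast
  refine le_min hhi ?_
  nlinarith [hmain, mul_nonneg_of_nonpos_of_nonpos (sub_nonpos.2 hkhi') (add_nonpos (le_trans hkhi' hq) hq)]

/-- **Solver-free spin ceiling from an energy ceiling and a docc floor** (`U > 0`): with
`KineticRow.of_energy_docc` (`k = e₀ − U d ≤ ehi − U·dlo =: khi ≤ 0`) every `spin_nn` cell clips at
`-(3/128) khi²`. [cite: LiebPRL1989, proof of Theorem 2] [cite: BratteliRobinsonII1997, §6.2.4] -/
theorem SpinNNRow.clip_energy_docc {U : ℝ} (hU : 0 < U) {lo hi elo ehi dlo dhi klo khi : ℚ}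
    (h : SpinNNRow U lo hi) (hel : M2EnergyLowerRow U elo) (heu : M2EnergyUpperRow U ehi)
    (hd : DoccRow U dlo dhi) (hklo : ((klo : ℚ) : ℝ) ≤ (elo : ℝ) - U * dhi)
    (hkhi : ((ehi : ℚ) : ℝ) - U * dlo ≤ ((khi : ℚ) : ℝ)) (hkhi0 : khi ≤ 0) :
    SpinNNRow U lo (min hi (-(3 * khi ^ 2 / 128))) :=
  h.clip_kinetic hU (KineticRow.of_energy_docc hU.le hel heu hd hklo hkhi) hkhi0

end M2

end Summit.Ventures.CertifiedManyBodySolver
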